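import Summits.QuantumFields.BalabanUV.Beta.D1BFx.NeedleGhostTadpoleRowClosed

/-!
# `BalabanUV.Beta.D1BFx.NeedleGhostTadpoleRowMass8` — road «BF-x» for binder row D1, slot (K), END row `hGrp gN`, (N-2) «NT-7» WITH TOLERANCE `n⁸`:
# **THE COMPLETED GHOST TADPOLE ROW `h₇` FROM THE SCALING LETTER `|ωgh n·(x₀ n·cQ n)| ≤ k·n⁸`** — four powers sharper than the record's
# `NeedleGhostTadpoleRowSharp.h₇_sharp` ∕ `NeedleGhostTadpoleRowClosed.h₇_of_scaling` (tolerance `n⁴`), obtained by ONE re-routing: the CROSS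
# placements of the averaging square go through the ghost leg's block-COLUMN |·|-mass (after the displaced bond is summed by M7 at a fixed site)
# instead of through its sup `2∕min 2 a`

HONEST DEPENDENCY (cell records, verbatim): «continuum YM on T⁴ ⇐ BetaPertH ∧ nine spine estimates (0/9 proved); BetaPertH ⇐ (D1) ∧ (D4) ∧
CAP+tail; G-an2-4 gates asym, D1 and NE2/3/4.»  HONEST FRAMING (cell contract, verbatim): «discharging `BetaPertH` makes Bałaban's UV stability
UNCONDITIONAL — a real constructive-QFT result; it is NOT the continuum limit and NOT the Clay problem.»  THIS MODULE DISCHARGES NOTHING of the wall: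
it is [folklore] finite bookkeeping BY NAME over this lineage's `NeedleGhostTadpoleRow{,Mass,Sharp,Closed}` (`abs_tadpole_le_sum_of_support`,
`qSqAt_eq_zero_of_not_mem_left∕right`, `WghAt_offDiag`, `T₇_eq_zero_of_far`, `sum_ball_abs_qJetAt_le`, `blk_resSite`, `sum_resSite_abs_qJetAt_le`,
`rowMass_Ggh_le_cNear`), gan24-leaf-05's M7 `NeedleBondMarginal`, `GhostLeg.Ggh_symm`, leaf A6 `ContactCount.abs_weight_le_of_mem_ball`.  The scaling
letter is a DISPLAYED hypothesis on ARBITRARY weight sequences; nothing about Bałaban's operators is asserted.  No `def`, no `def … : Prop`, nothing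
cited, 0 sorry.  Root-level binders hW ∕ hR-sockets ∕ hSX-socket ∕ D1Tel ∕ D1Rep — 0 discharged; (K) NOT closed; NOT D1, NOT `BetaPertH`, NOT
continuum, NOT Clay.  READING NOTE (owner rulings ρ-g11-9∕ρ-g11-11): under the END of record's `hω` (reading (i)) the letter of `h₇` reads `4N²a·n⁴`
(`NeedleRowsAtRay.abs_weight₇_le_of_ray`); under the physical reading (ii) ∕ ENDₛ at `s n = n⁻²` it reads `4N²a·n⁸` — THIS file is the count that
meets the latter; END-ii ∕ ENDₛ themselves are NOT in the tree.

ABSOLUTE RULE (cell charter, verbatim): «No internally-minted statement may enter as a cited fact. Every hypothesis is either kernel-proved in this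
package or a verbatim quotation of a PUBLISHED theorem with page reference. The manuscript(s) under audit are NOT citable for their own disputed
steps — they are the thing under adjudication; programme-internal (2001/route/tribunal) claims are never citable.»

WHY (stub `HOME/b2b-balaban-beta-d1-formalise-leaf-04/g12/T7-ii-STUB.md`, journal [D1LEAF04-G12-T7STUB]).  The record's row bound
`abs_row₇_le_sharp` is `|ωgh|·|x₀cQ|·n⁻⁸·(n−1)⁴·(M·n⁻⁴ + 2∕min 2 a)`: the DIAGONAL placements (leg through its block-row mass `M`) sit at `n⁻⁸`, the
CROSS placements (leg through its sup) at `n⁻⁴`.  Keeping the kernel in the cross placements, `Σ_{x,z} |G x z|·J_u x·J′ z = Σ_z J′ z·Σ_x |G x z|·J_u x`,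
summing the displaced bond `u = b + w` FIRST at fixed `x` (`Σ_w |J_{b+w} x| ≤ (n−1)·n⁻⁴`, M7) and THEN the site through the column mass
(`Σ_x |G x z| ≤ M`, `Ggh_symm`) puts the cross class at `M·n⁻⁴` too.
CONTENT (all [folklore]; `Y := blk b`, `J_u x := |qJetAt (ctrHalf n) n μ u Y x|`, `J′ x := |qJetAt (ctrHalf n) n ν b Y x|`):
* §1 **`abs_tadpole_qSqAt_le_massKernel`** (`|tadpole (Ggh) (qSqAt ρ n κ u l u′)| ≤ 2M·Σ_x J_u x·J′ x + 2·Σ_z J′ z·Σ_x |Ggh x z|·J_u x`),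
  **`abs_T₇_le_massKernel`** (the word at `w ≠ 0`, × `½|x₀cQ|n⁴`).
* §2 **`abs_fullSum_T₇_le_sharp₈`** (`|n⁻⁸·fullSum_b| ≤ |x₀cQ|·(n⁻⁴·((n−1)²·((n−1)·((2M·n⁻⁴)·Σ_x J′_b x))))`).
* §3 **`abs_row₇_le_sharp₈`**, and in the glue's currency **`h₇_sharp₈ (ha) (hM0) (hk : |ωgh n·(x₀ n·cQ n)| ≤ k·n⁸) ⊢ h₇`, `C₇ := k·(2·cM)`**;
  **`h₇_of_scaling₈`** (`hM0` discharged by `rowMass_Ggh_le_cNear`, `C₇ := k·(2·cNear a)`).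
Unit `b2b-balaban-beta-d1-formalise-leaf-04` (gen 12), D1 formalisation swarm; `LEAVES-BFx.md` row (N) ∕ «NT-7»; cell T₇-ii (ρ-g11-11 (4)(c)).
-/

noncomputable section

namespace Summit.QuantumFields.BalabanUV.Beta.D1BFx.NeedleGhostTadpoleRowMass8

open Finset Filter Topology
open scoped BigOperators
open Literature.MathematicalPhysics.QuantumFieldTheory.Balaban1983to89
open Literature.MathematicalPhysics.QuantumFieldTheory.Balaban1983to89.Beta
open B6QGQLower276 (blk B mem_B side)
open ExpKernelCalculus (Site MKer tadpole)
open Literature.Probability.LatticeModels (annulus)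
open DyadicShell (Pt toReal supNorm mem_annulus_iff supNorm_eq_zero_iff)
open WindowIdentification (psum fullSum fullSum_of_support)
open DressedMomentNormalisation (resSite)
open KernelReflection (tadpole_smul)
open Summit.QuantumFields.BalabanUV.Beta.D1BFx.DressedTablesLeg (tadpoleTableA tadpoleTableA_apply)
open Summit.QuantumFields.BalabanUV.Beta.D1BFx.ContactCount (abs_weight_le_of_mem_ball)
open Summit.QuantumFields.BalabanUV.Beta.D1BFx.GhostLeg (Ggh bdd_Ggh Ggh_symm side_pred)
open Summit.QuantumFields.BalabanUV.Beta.D1BFx.GhostStencilRooted (qJetAt qAntiAt qAntiAt_apply)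
open Summit.QuantumFields.BalabanUV.Beta.D1BFx.GhostStencilRootedReflection (ctrHalf ctrHalf_mem)
open Summit.QuantumFields.BalabanUV.Beta.D1BFx.GhostAveragingSquare (qSqAt qSqAt_apply WghAt)
open Summit.QuantumFields.BalabanUV.Beta.D1BFx.GhostNeedleRootedLetters (sum_B_const')
open Summit.QuantumFields.BalabanUV.Beta.D1BFx.GhostLegBlockMass (cNear)
open Summit.QuantumFields.BalabanUV.Beta.D1BFx.NeedleBondMarginal (sum_bond_abs_qJetAt_le_of_root)
open Summit.QuantumFields.BalabanUV.Beta.D1BFx.NeedleGhostTadpoleRow (qSqAt_eq_zero_of_not_mem_left qSqAt_eq_zero_of_not_mem_right WghAt_offDiag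
  T₇_eq_zero_of_far)
open Summit.QuantumFields.BalabanUV.Beta.D1BFx.NeedleGhostTadpoleRowMass (abs_tadpole_le_sum_of_support)
open Summit.QuantumFields.BalabanUV.Beta.D1BFx.NeedleGhostTadpoleRowSharp (sum_ball_abs_qJetAt_le blk_resSite sum_resSite_abs_qJetAt_le)
open Summit.QuantumFields.BalabanUV.Beta.D1BFx.NeedleGhostTadpoleRowClosed (rowMass_Ggh_le_cNear)

/-! ## §1 The averaging-square tadpole by placements: diagonal → block-row mass, cross → KERNEL KEPT -/

section Placements

variable (ρ : Site 4) (n : ℕ) [NeZero n] {a : ℝ}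

/-- [folklore] **THE GHOST TADPOLE OF THE AVERAGING SQUARE BY PLACEMENTS, CROSS KERNEL KEPT.**  On the common block `B(Y)`, `Y = blk u′`, with
`J x := |qJetAt … κ u Y x|`, `J′ x := |qJetAt … l u′ Y x|` and the leg's block-row |·|-mass `M`, the two DIAGONAL placements give `2M·Σ_x J x·J′ x` as in
`NeedleGhostTadpoleRowSharp.abs_tadpole_qSqAt_le_placements`, while the two CROSS placements are kept as `2·Σ_z J′ z·Σ_x |Ggh x z|·J x` (`Ggh_symm`). -/
theorem abs_tadpole_qSqAt_le_massKernel (ha : 0 < a) (κ : Fin 4) (u : Site 4) (l : Fin 4) (u' : Site 4) {M : ℝ}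
    (hM : ∀ x : Site 4, ∑ z ∈ B (n - 1) (blk (n - 1) u'), |Ggh n a x z () ()| ≤ M) :
    |tadpole (Ggh n a) (qSqAt ρ n κ u l u')| ≤
      2 * M * ∑ x ∈ B (n - 1) (blk (n - 1) u'), |qJetAt ρ n κ u (blk (n - 1) u') x| * |qJetAt ρ n l u' (blk (n - 1) u') x|
      + 2 * ∑ z ∈ B (n - 1) (blk (n - 1) u'), |qJetAt ρ n l u' (blk (n - 1) u') z| *
          ∑ x ∈ B (n - 1) (blk (n - 1) u'), |Ggh n a x z () ()| * |qJetAt ρ n κ u (blk (n - 1) u') x| := by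
  set Y := blk (n - 1) u' with hY
  set T := B (n - 1) Y with hT
  set J : Site 4 → ℝ := fun x => |qJetAt ρ n κ u Y x| with hJ
  set J' : Site 4 → ℝ := fun x => |qJetAt ρ n l u' Y x| with hJ'
  set G : Site 4 → Site 4 → ℝ := fun x z => |Ggh n a x z () ()| with hG
  have hG0 : ∀ x z, 0 ≤ G x z := fun x z => abs_nonneg _
  have hGs : ∀ x z, G x z = G z x := fun x z => by simp only [hG]; rw [Ggh_symm n a ha x z () ()]
  have hJ0 : ∀ x, 0 ≤ J x := fun x => abs_nonneg _
  have hJ'0 : ∀ x, 0 ≤ J' x := fun x => abs_nonneg _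
  have hrow : ∀ x, ∑ z ∈ T, G x z ≤ M := fun x => hM x
  have hcol : ∀ z, ∑ x ∈ T, G x z ≤ M := by
    intro z
    have e : ∑ x ∈ T, G x z = ∑ x ∈ T, |Ggh n a z x () ()| :=
      Finset.sum_congr rfl fun x _ => by simp only [hG]; rw [Ggh_symm n a ha x z () ()]
    rw [e]; exact hM z
  -- the square on the block: `|qSqAt z x| ≤ (J x + J z)·(J′ x + J′ z)`
  have hq : ∀ x ∈ T, ∀ z ∈ T, |qSqAt ρ n κ u l u' z x () ()| ≤ (J x + J z) * (J' x + J' z) := by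
    intro x hx z hz
    have hbx : blk (n - 1) x = Y := mem_B.1 hx
    have hbz : blk (n - 1) z = Y := mem_B.1 hz
    rw [qSqAt_apply, abs_mul, qAntiAt_apply, qAntiAt_apply, hbx, hbz]
    exact mul_le_mul (abs_sub _ _) (abs_sub _ _) (abs_nonneg _) (add_nonneg (hJ0 x) (hJ0 z))
  have h0 := abs_tadpole_le_sum_of_support (A := Ggh n a) (V := qSqAt ρ n κ u l u') T
    (fun y hy x f a' => qSqAt_eq_zero_of_not_mem_left ρ n κ u l u' y hy x f a')
    (fun x hx y f a' => qSqAt_eq_zero_of_not_mem_right ρ n κ u l u' x hx y f a')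
  have h1 : ∑ x ∈ T, ∑ a' : Unit, ∑ z ∈ T, ∑ f' : Unit, |Ggh n a x z a' f'| * |qSqAt ρ n κ u l u' z x f' a'|
      = ∑ x ∈ T, ∑ z ∈ T, G x z * |qSqAt ρ n κ u l u' z x () ()| := by
    simp only [Fintype.sum_unique, PUnit.default_eq_unit]
    rfl
  have expand : ∀ x z, G x z * ((J x + J z) * (J' x + J' z)) =
      G x z * (J x * J' x) + G x z * (J x * J' z) + G x z * (J z * J' x) + G x z * (J z * J' z) := fun x z => by ring
  -- the two diagonal placements (as in the record)
  have p1 : ∑ x ∈ T, ∑ z ∈ T, G x z * (J x * J' x) ≤ M * ∑ x ∈ T, J x * J' x := by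
    calc ∑ x ∈ T, ∑ z ∈ T, G x z * (J x * J' x) = ∑ x ∈ T, (J x * J' x) * ∑ z ∈ T, G x z := by
          refine Finset.sum_congr rfl fun x _ => ?_
          rw [Finset.mul_sum]; exact Finset.sum_congr rfl fun z _ => by ring
      _ ≤ ∑ x ∈ T, (J x * J' x) * M := Finset.sum_le_sum fun x _ => mul_le_mul_of_nonneg_left (hrow x) (mul_nonneg (hJ0 x) (hJ'0 x))
      _ = M * ∑ x ∈ T, J x * J' x := by rw [Finset.mul_sum]; exact Finset.sum_congr rfl fun x _ => by ring
  have p4 : ∑ x ∈ T, ∑ z ∈ T, G x z * (J z * J' z) ≤ M * ∑ x ∈ T, J x * J' x := by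
    rw [Finset.sum_comm]
    calc ∑ z ∈ T, ∑ x ∈ T, G x z * (J z * J' z) = ∑ z ∈ T, (J z * J' z) * ∑ x ∈ T, G x z := by
          refine Finset.sum_congr rfl fun z _ => ?_
          rw [Finset.mul_sum]; exact Finset.sum_congr rfl fun x _ => by ring
      _ ≤ ∑ z ∈ T, (J z * J' z) * M := Finset.sum_le_sum fun z _ => mul_le_mul_of_nonneg_left (hcol z) (mul_nonneg (hJ0 z) (hJ'0 z))
      _ = M * ∑ x ∈ T, J x * J' x := by rw [Finset.mul_sum]; exact Finset.sum_congr rfl fun x _ => by ring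
  -- the two cross placements, kernel kept: both equal `Σ_z J′ z · Σ_x G x z · J x`
  have p2 : ∑ x ∈ T, ∑ z ∈ T, G x z * (J x * J' z) = ∑ z ∈ T, J' z * ∑ x ∈ T, G x z * J x := by
    rw [Finset.sum_comm]
    refine Finset.sum_congr rfl fun z _ => ?_
    rw [Finset.mul_sum]
    exact Finset.sum_congr rfl fun x _ => by ring
  have p3 : ∑ x ∈ T, ∑ z ∈ T, G x z * (J z * J' x) = ∑ z ∈ T, J' z * ∑ x ∈ T, G x z * J x := by
    -- rename `(x, z) ↦ (z, x)` and use the symmetry of the leg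
    calc ∑ x ∈ T, ∑ z ∈ T, G x z * (J z * J' x) = ∑ x ∈ T, J' x * ∑ z ∈ T, G z x * J z := by
          refine Finset.sum_congr rfl fun x _ => ?_
          rw [Finset.mul_sum]
          exact Finset.sum_congr rfl fun z _ => by rw [hGs x z]; ring
      _ = ∑ z ∈ T, J' z * ∑ x ∈ T, G x z * J x := rfl
  calc |tadpole (Ggh n a) (qSqAt ρ n κ u l u')|
      ≤ ∑ x ∈ T, ∑ z ∈ T, G x z * |qSqAt ρ n κ u l u' z x () ()| := h1 ▸ h0
    _ ≤ ∑ x ∈ T, ∑ z ∈ T, G x z * ((J x + J z) * (J' x + J' z)) :=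
        Finset.sum_le_sum fun x hx => Finset.sum_le_sum fun z hz => mul_le_mul_of_nonneg_left (hq x hx z hz) (hG0 x z)
    _ = (∑ x ∈ T, ∑ z ∈ T, G x z * (J x * J' x)) + (∑ x ∈ T, ∑ z ∈ T, G x z * (J x * J' z))
        + (∑ x ∈ T, ∑ z ∈ T, G x z * (J z * J' x)) + (∑ x ∈ T, ∑ z ∈ T, G x z * (J z * J' z)) := by
        simp only [expand, Finset.sum_add_distrib]
    _ ≤ M * (∑ x ∈ T, J x * J' x) + (∑ z ∈ T, J' z * ∑ x ∈ T, G x z * J x)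
        + (∑ z ∈ T, J' z * ∑ x ∈ T, G x z * J x) + M * (∑ x ∈ T, J x * J' x) :=
        add_le_add (add_le_add (add_le_add p1 p2.le) p3.le) p4
    _ = 2 * M * (∑ x ∈ T, J x * J' x) + 2 * ∑ z ∈ T, J' z * ∑ x ∈ T, G x z * J x := by ring

variable (x₀ cK cQ : ℝ)

/-- [folklore] **THE COMPLETED GHOST TADPOLE WORD BY PLACEMENTS, CROSS KERNEL KEPT** (`w ≠ 0`: the kinetic contact has dropped, `WghAt_offDiag`):
`|tadpoleTableA (Ggh n a) (WghAt ρ n x₀ cK cQ) μ ν (b+w) b| ≤ ½·|x₀cQ|·n⁴·(2M·Σ_x J_{b+w} x·J′_b x + 2·Σ_z J′_b z·Σ_x |Ggh x z|·J_{b+w} x)`. -/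
theorem abs_T₇_le_massKernel (ha : 0 < a) (μ ν : Fin 4) (b : Pt) {w : Pt} (hw : w ≠ 0) {M : ℝ}
    (hM : ∀ x : Site 4, ∑ z ∈ B (n - 1) (blk (n - 1) b), |Ggh n a x z () ()| ≤ M) :
    |tadpoleTableA (Ggh n a) (WghAt ρ n x₀ cK cQ) μ ν (b + w) b| ≤
      1 / 2 * (|x₀ * cQ| * (n : ℝ) ^ 4) *
        (2 * M * ∑ x ∈ B (n - 1) (blk (n - 1) b), |qJetAt ρ n μ (b + w) (blk (n - 1) b) x| * |qJetAt ρ n ν b (blk (n - 1) b) x|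
          + 2 * ∑ z ∈ B (n - 1) (blk (n - 1) b), |qJetAt ρ n ν b (blk (n - 1) b) z| *
              ∑ x ∈ B (n - 1) (blk (n - 1) b), |Ggh n a x z () ()| * |qJetAt ρ n μ (b + w) (blk (n - 1) b) x|) := by
  have hn : (0 : ℝ) < n := by exact_mod_cast Nat.pos_of_ne_zero (NeZero.ne n)
  have hbw : b + w ≠ b := fun e => hw (by simpa using e)
  rw [tadpoleTableA_apply, WghAt_offDiag ρ n x₀ cK cQ μ ν hbw, tadpole_smul, abs_mul, abs_mul,
    abs_of_pos (by norm_num : (0 : ℝ) < 1 / 2)]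
  have hc : |(-(x₀ * cQ * (n : ℝ) ^ 4))| = |x₀ * cQ| * (n : ℝ) ^ 4 := by
    rw [abs_neg, abs_mul, abs_of_pos (pow_pos hn 4)]
  rw [hc]
  have hP := abs_tadpole_qSqAt_le_massKernel ρ n ha μ (b + w) ν b hM
  calc 1 / 2 * (|x₀ * cQ| * (n : ℝ) ^ 4 * |tadpole (Ggh n a) (qSqAt ρ n μ (b + w) ν b)|)
      ≤ 1 / 2 * (|x₀ * cQ| * (n : ℝ) ^ 4 *
        (2 * M * ∑ x ∈ B (n - 1) (blk (n - 1) b), |qJetAt ρ n μ (b + w) (blk (n - 1) b) x| * |qJetAt ρ n ν b (blk (n - 1) b) x|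
          + 2 * ∑ z ∈ B (n - 1) (blk (n - 1) b), |qJetAt ρ n ν b (blk (n - 1) b) z| *
              ∑ x ∈ B (n - 1) (blk (n - 1) b), |Ggh n a x z () ()| * |qJetAt ρ n μ (b + w) (blk (n - 1) b) x|)) := by gcongr
    _ = _ := by ring

end Placements

/-! ## §2 At a base bond: the displaced bond summed FIRST in both classes (M7), then the column mass -/

section Base

variable (n : ℕ) [NeZero n] {a : ℝ} (x₀ cK cQ : ℝ)

/-- [folklore] **THE COMPLETED GHOST TADPOLE ROW AT A BASE BOND, TOLERANCE-`n⁸` FORM**: with `Y = blk b`, `J′_b x := qJetAt (ctrHalf n) n ν b Y x` and the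
leg's block-row |·|-mass `M` on `B(Y)`:
`|n⁻⁸ · fullSum (w ↦ w_μw_ν·T₇(b+w,b))| ≤ |x₀cQ|·(n⁻⁴·((n−1)²·((n−1)·((2M·n⁻⁴)·Σ_{x ∈ B(Y)} |J′_b x|))))` — the record's `abs_fullSum_T₇_le_sharp` with
`(M·n⁻⁴ + 2∕min 2 a)` replaced by `2M·n⁻⁴`: in the cross class the displaced bond is summed at a fixed site (`sum_ball_abs_qJetAt_le`) BEFORE the site is
summed against the column mass. -/
theorem abs_fullSum_T₇_le_sharp₈ (ha : 0 < a) (μ ν : Fin 4) (b : Pt) {M : ℝ}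
    (hM : ∀ x : Site 4, ∑ z ∈ B (n - 1) (blk (n - 1) b), |Ggh n a x z () ()| ≤ M) :
    |((n : ℝ) ^ 8)⁻¹ * fullSum (fun w : Pt => toReal w μ * toReal w ν *
        tadpoleTableA (Ggh n a) (WghAt (ctrHalf n) n x₀ cK cQ) μ ν (b + w) b)| ≤
      |x₀ * cQ| * (((n : ℝ) ^ 4)⁻¹ * ((((n - 1 : ℕ) : ℝ)) ^ 2 * (((n : ℝ) - 1) *
        ((2 * M * ((n : ℝ) ^ 4)⁻¹) * ∑ x ∈ B (n - 1) (blk (n - 1) b), |qJetAt (ctrHalf n) n ν b (blk (n - 1) b) x|)))) := by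
  have hn1 : (1 : ℝ) ≤ n := by exact_mod_cast NeZero.one_le
  have hn : (0 : ℝ) < n := by linarith
  have hM0 : 0 ≤ M := (Finset.sum_nonneg fun z _ => abs_nonneg _).trans (hM 0)
  set Y := blk (n - 1) b with hY
  set A : ℝ := ∑ x ∈ B (n - 1) Y, |qJetAt (ctrHalf n) n ν b Y x| with hA
  have hA0 : 0 ≤ A := Finset.sum_nonneg fun x _ => abs_nonneg _
  set K : Pt → ℝ := fun w => toReal w μ * toReal w ν * tadpoleTableA (Ggh n a) (WghAt (ctrHalf n) n x₀ cK cQ) μ ν (b + w) b with hK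
  have hfar : ∀ w : Pt, n - 1 < supNorm w → K w = 0 := fun w hw => by
    simp only [hK]; rw [T₇_eq_zero_of_far (ctrHalf n) n x₀ cK cQ μ ν b w hw, mul_zero]
  rw [fullSum_of_support hfar]
  -- column mass (`Ggh_symm`)
  have hcol : ∀ z : Site 4, ∑ x ∈ B (n - 1) Y, |Ggh n a x z () ()| ≤ M := by
    intro z
    have e : ∑ x ∈ B (n - 1) Y, |Ggh n a x z () ()| = ∑ x ∈ B (n - 1) Y, |Ggh n a z x () ()| :=
      Finset.sum_congr rfl fun x _ => by rw [Ggh_symm n a ha x z () ()]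
    rw [e]; exact hM z
  -- pointwise on the ball: weight `(n−1)²` × placements
  have hpt : ∀ w ∈ annulus 4 0 (n - 1), |K w| ≤ (((n - 1 : ℕ) : ℝ)) ^ 2 * (1 / 2 * (|x₀ * cQ| * (n : ℝ) ^ 4) *
      (2 * M * ∑ x ∈ B (n - 1) Y, |qJetAt (ctrHalf n) n μ (b + w) Y x| * |qJetAt (ctrHalf n) n ν b Y x|
        + 2 * ∑ z ∈ B (n - 1) Y, |qJetAt (ctrHalf n) n ν b Y z| *
            ∑ x ∈ B (n - 1) Y, |Ggh n a x z () ()| * |qJetAt (ctrHalf n) n μ (b + w) Y x|)) := by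
    intro w hw
    have hw0 : w ≠ 0 := fun e => by
      have h1 := (mem_annulus_iff.mp hw).1
      rw [e, supNorm_eq_zero_iff.mpr rfl] at h1
      exact lt_irrefl _ h1
    simp only [hK]
    rw [abs_mul]
    exact mul_le_mul (abs_weight_le_of_mem_ball hw μ ν) (abs_T₇_le_massKernel (ctrHalf n) n x₀ cK cQ ha μ ν b hw0 hM) (abs_nonneg _)
      (by positivity)
  -- the displaced-bond sums (M7), diagonal class
  have hD : ∑ w ∈ annulus 4 0 (n - 1), ∑ x ∈ B (n - 1) Y, |qJetAt (ctrHalf n) n μ (b + w) Y x| * |qJetAt (ctrHalf n) n ν b Y x|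
      ≤ ((n : ℝ) - 1) * ((n : ℝ) ^ 4)⁻¹ * A := by
    rw [Finset.sum_comm]
    calc ∑ x ∈ B (n - 1) Y, ∑ w ∈ annulus 4 0 (n - 1), |qJetAt (ctrHalf n) n μ (b + w) Y x| * |qJetAt (ctrHalf n) n ν b Y x|
        = ∑ x ∈ B (n - 1) Y, (∑ w ∈ annulus 4 0 (n - 1), |qJetAt (ctrHalf n) n μ (b + w) Y x|) * |qJetAt (ctrHalf n) n ν b Y x| := by
          refine Finset.sum_congr rfl fun x _ => by rw [Finset.sum_mul]
      _ ≤ ∑ x ∈ B (n - 1) Y, (((n : ℝ) - 1) * ((n : ℝ) ^ 4)⁻¹) * |qJetAt (ctrHalf n) n ν b Y x| :=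
          Finset.sum_le_sum fun x _ => mul_le_mul_of_nonneg_right (sum_ball_abs_qJetAt_le n μ b Y x) (abs_nonneg _)
      _ = ((n : ℝ) - 1) * ((n : ℝ) ^ 4)⁻¹ * A := by rw [← Finset.mul_sum]
  -- the displaced-bond sums (M7), cross class: bond first at fixed site, then the column mass
  have hC : ∑ w ∈ annulus 4 0 (n - 1), ∑ z ∈ B (n - 1) Y, |qJetAt (ctrHalf n) n ν b Y z| *
      ∑ x ∈ B (n - 1) Y, |Ggh n a x z () ()| * |qJetAt (ctrHalf n) n μ (b + w) Y x|
      ≤ ((n : ℝ) - 1) * ((n : ℝ) ^ 4)⁻¹ * M * A := by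
    rw [Finset.sum_comm]
    have hz : ∀ z ∈ B (n - 1) Y, ∑ w ∈ annulus 4 0 (n - 1), |qJetAt (ctrHalf n) n ν b Y z| *
        ∑ x ∈ B (n - 1) Y, |Ggh n a x z () ()| * |qJetAt (ctrHalf n) n μ (b + w) Y x|
        ≤ |qJetAt (ctrHalf n) n ν b Y z| * (((n : ℝ) - 1) * ((n : ℝ) ^ 4)⁻¹ * M) := by
      intro z _
      rw [← Finset.mul_sum]
      refine mul_le_mul_of_nonneg_left ?_ (abs_nonneg _)
      rw [Finset.sum_comm]
      calc ∑ x ∈ B (n - 1) Y, ∑ w ∈ annulus 4 0 (n - 1), |Ggh n a x z () ()| * |qJetAt (ctrHalf n) n μ (b + w) Y x|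
          = ∑ x ∈ B (n - 1) Y, |Ggh n a x z () ()| * ∑ w ∈ annulus 4 0 (n - 1), |qJetAt (ctrHalf n) n μ (b + w) Y x| := by
            refine Finset.sum_congr rfl fun x _ => by rw [Finset.mul_sum]
        _ ≤ ∑ x ∈ B (n - 1) Y, |Ggh n a x z () ()| * (((n : ℝ) - 1) * ((n : ℝ) ^ 4)⁻¹) :=
            Finset.sum_le_sum fun x _ => mul_le_mul_of_nonneg_left (sum_ball_abs_qJetAt_le n μ b Y x) (abs_nonneg _)
        _ = (∑ x ∈ B (n - 1) Y, |Ggh n a x z () ()|) * (((n : ℝ) - 1) * ((n : ℝ) ^ 4)⁻¹) := by rw [Finset.sum_mul]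
        _ ≤ M * (((n : ℝ) - 1) * ((n : ℝ) ^ 4)⁻¹) := mul_le_mul_of_nonneg_right (hcol z) (by positivity)
        _ = ((n : ℝ) - 1) * ((n : ℝ) ^ 4)⁻¹ * M := by ring
    calc ∑ z ∈ B (n - 1) Y, ∑ w ∈ annulus 4 0 (n - 1), |qJetAt (ctrHalf n) n ν b Y z| *
          ∑ x ∈ B (n - 1) Y, |Ggh n a x z () ()| * |qJetAt (ctrHalf n) n μ (b + w) Y x|
        ≤ ∑ z ∈ B (n - 1) Y, |qJetAt (ctrHalf n) n ν b Y z| * (((n : ℝ) - 1) * ((n : ℝ) ^ 4)⁻¹ * M) := Finset.sum_le_sum hz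
      _ = ((n : ℝ) - 1) * ((n : ℝ) ^ 4)⁻¹ * M * A := by rw [← Finset.sum_mul]; ring
  -- assemble
  have hsum : ∑ w ∈ annulus 4 0 (n - 1), |K w| ≤ (((n - 1 : ℕ) : ℝ)) ^ 2 * (1 / 2 * (|x₀ * cQ| * (n : ℝ) ^ 4) *
      (2 * M * (((n : ℝ) - 1) * ((n : ℝ) ^ 4)⁻¹ * A) + 2 * (((n : ℝ) - 1) * ((n : ℝ) ^ 4)⁻¹ * M * A))) := by
    refine (Finset.sum_le_sum hpt).trans ?_
    rw [← Finset.mul_sum, ← Finset.mul_sum]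
    refine mul_le_mul_of_nonneg_left (mul_le_mul_of_nonneg_left ?_ (by positivity)) (by positivity)
    rw [Finset.sum_add_distrib, ← Finset.mul_sum, ← Finset.mul_sum]
    exact add_le_add (mul_le_mul_of_nonneg_left hD (by positivity)) (mul_le_mul_of_nonneg_left hC (by positivity))
  rw [abs_mul, abs_of_nonneg (by positivity : (0 : ℝ) ≤ ((n : ℝ) ^ 8)⁻¹)]
  calc ((n : ℝ) ^ 8)⁻¹ * |∑ w ∈ annulus 4 0 (n - 1), K w|
      ≤ ((n : ℝ) ^ 8)⁻¹ * ∑ w ∈ annulus 4 0 (n - 1), |K w| :=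
        mul_le_mul_of_nonneg_left (Finset.abs_sum_le_sum_abs _ _) (by positivity)
    _ ≤ ((n : ℝ) ^ 8)⁻¹ * ((((n - 1 : ℕ) : ℝ)) ^ 2 * (1 / 2 * (|x₀ * cQ| * (n : ℝ) ^ 4) *
      (2 * M * (((n : ℝ) - 1) * ((n : ℝ) ^ 4)⁻¹ * A) + 2 * (((n : ℝ) - 1) * ((n : ℝ) ^ 4)⁻¹ * M * A)))) :=
        mul_le_mul_of_nonneg_left hsum (by positivity)
    _ = |x₀ * cQ| * (((n : ℝ) ^ 4)⁻¹ * ((((n - 1 : ℕ) : ℝ)) ^ 2 * (((n : ℝ) - 1) *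
        ((2 * M * ((n : ℝ) ^ 4)⁻¹) * A)))) := by
        field_simp
        ring

end Base

/-! ## §3 Over the base bonds (M7), and `h₇` with tolerance `n⁸` -/

section Row

variable (n : ℕ) [NeZero n] {a : ℝ} (x₀ cK cQ : ℝ)

/-- [folklore] **THE COMPLETED GHOST TADPOLE ROW AT FIXED `n`, TOLERANCE-`n⁸` FORM**: with the leg's block-row |·|-mass `M` on the block of the origin,
`|ωgh · Σ_{b ∈ image resSite} n⁻⁴·(n⁻⁸·fullSum (…))| ≤ |ωgh|·(|x₀cQ|·(n⁻⁸·((n−1)²·((n−1)²·(2M·n⁻⁴)))))` (the record's `abs_row₇_le_sharp` with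
`(M·n⁻⁴ + 2∕min 2 a) ↦ 2M·n⁻⁴`). -/
theorem abs_row₇_le_sharp₈ (ha : 0 < a) (ωgh : ℝ) (μ ν : Fin 4) {M : ℝ}
    (hM : ∀ x : Site 4, ∑ z ∈ B (n - 1) 0, |Ggh n a x z () ()| ≤ M) :
    |ωgh * ∑ b ∈ (univ : Finset (Fin 4 → Fin n)).image resSite, ((n : ℝ) ^ 4)⁻¹ * (((n : ℝ) ^ 8)⁻¹ *
        fullSum (fun w : Pt => toReal w μ * toReal w ν * tadpoleTableA (Ggh n a) (WghAt (ctrHalf n) n x₀ cK cQ) μ ν (b + w) b))| ≤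
      |ωgh| * (|x₀ * cQ| * (((n : ℝ) ^ 8)⁻¹ * ((((n - 1 : ℕ) : ℝ)) ^ 2 * (((n : ℝ) - 1) ^ 2 * (2 * M * ((n : ℝ) ^ 4)⁻¹))))) := by
  have hn1 : (1 : ℝ) ≤ n := by exact_mod_cast NeZero.one_le
  have hn : (0 : ℝ) < n := by linarith
  have hM0 : 0 ≤ M := (Finset.sum_nonneg fun z _ => abs_nonneg _).trans (hM 0)
  set R := (univ : Finset (Fin 4 → Fin n)).image (resSite (d := 4) (N := n)) with hR
  have hblk : ∀ b ∈ R, blk (n - 1) b = 0 := by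
    intro b hb
    obtain ⟨r, _, rfl⟩ := Finset.mem_image.1 hb
    exact blk_resSite n r
  -- per base bond (§2), with `Y = 0`
  have hb : ∀ b ∈ R, |((n : ℝ) ^ 4)⁻¹ * (((n : ℝ) ^ 8)⁻¹ *
      fullSum (fun w : Pt => toReal w μ * toReal w ν * tadpoleTableA (Ggh n a) (WghAt (ctrHalf n) n x₀ cK cQ) μ ν (b + w) b))| ≤
      ((n : ℝ) ^ 4)⁻¹ * (|x₀ * cQ| * (((n : ℝ) ^ 4)⁻¹ * ((((n - 1 : ℕ) : ℝ)) ^ 2 * (((n : ℝ) - 1) *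
        ((2 * M * ((n : ℝ) ^ 4)⁻¹) * ∑ x ∈ B (n - 1) 0, |qJetAt (ctrHalf n) n ν b 0 x|))))) := by
    intro b hbR
    have hY := hblk b hbR
    have hMb : ∀ x : Site 4, ∑ z ∈ B (n - 1) (blk (n - 1) b), |Ggh n a x z () ()| ≤ M := by rw [hY]; exact hM
    have h := abs_fullSum_T₇_le_sharp₈ n x₀ cK cQ ha μ ν b hMb
    rw [hY] at h
    rw [abs_mul, abs_of_nonneg (by positivity : (0 : ℝ) ≤ ((n : ℝ) ^ 4)⁻¹)]
    exact mul_le_mul_of_nonneg_left h (by positivity)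
  -- the base-bond sum by M7, fine site by fine site
  have hBase : ∑ b ∈ R, ∑ x ∈ B (n - 1) 0, |qJetAt (ctrHalf n) n ν b 0 x| ≤ (n : ℝ) ^ 4 * (((n : ℝ) - 1) * ((n : ℝ) ^ 4)⁻¹) := by
    rw [Finset.sum_comm]
    calc ∑ x ∈ B (n - 1) 0, ∑ b ∈ R, |qJetAt (ctrHalf n) n ν b 0 x|
        ≤ ∑ _x ∈ B (n - 1) 0, ((n : ℝ) - 1) * ((n : ℝ) ^ 4)⁻¹ := Finset.sum_le_sum fun x _ => sum_resSite_abs_qJetAt_le n ν x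
      _ = (n : ℝ) ^ 4 * (((n : ℝ) - 1) * ((n : ℝ) ^ 4)⁻¹) := sum_B_const' n 0 _
  rw [abs_mul]
  refine mul_le_mul_of_nonneg_left ?_ (abs_nonneg ωgh)
  set c : ℝ := ((n : ℝ) ^ 4)⁻¹ * (|x₀ * cQ| * (((n : ℝ) ^ 4)⁻¹ * ((((n - 1 : ℕ) : ℝ)) ^ 2 * (((n : ℝ) - 1) *
        (2 * M * ((n : ℝ) ^ 4)⁻¹))))) with hc
  have hc0 : 0 ≤ c := by positivity
  calc |∑ b ∈ R, ((n : ℝ) ^ 4)⁻¹ * (((n : ℝ) ^ 8)⁻¹ *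
        fullSum (fun w : Pt => toReal w μ * toReal w ν * tadpoleTableA (Ggh n a) (WghAt (ctrHalf n) n x₀ cK cQ) μ ν (b + w) b))|
      ≤ ∑ b ∈ R, |((n : ℝ) ^ 4)⁻¹ * (((n : ℝ) ^ 8)⁻¹ *
        fullSum (fun w : Pt => toReal w μ * toReal w ν * tadpoleTableA (Ggh n a) (WghAt (ctrHalf n) n x₀ cK cQ) μ ν (b + w) b))| :=
        Finset.abs_sum_le_sum_abs _ _
    _ ≤ ∑ b ∈ R, c * ∑ x ∈ B (n - 1) 0, |qJetAt (ctrHalf n) n ν b 0 x| := by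
        refine Finset.sum_le_sum fun b hbR => (hb b hbR).trans (le_of_eq ?_)
        simp only [hc]; ring
    _ = c * ∑ b ∈ R, ∑ x ∈ B (n - 1) 0, |qJetAt (ctrHalf n) n ν b 0 x| := by rw [Finset.mul_sum]
    _ ≤ c * ((n : ℝ) ^ 4 * (((n : ℝ) - 1) * ((n : ℝ) ^ 4)⁻¹)) := mul_le_mul_of_nonneg_left hBase hc0
    _ = |x₀ * cQ| * (((n : ℝ) ^ 8)⁻¹ * ((((n - 1 : ℕ) : ℝ)) ^ 2 * (((n : ℝ) - 1) ^ 2 * (2 * M * ((n : ℝ) ^ 4)⁻¹)))) := by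
        simp only [hc]; field_simp

end Row

/-! ## §3′ In the glue's currency: `h₇` with tolerance `n⁸` -/

section Glue

variable {a : ℝ} {x₀ cK cQ ωgh : ℕ → ℝ} {k cM : ℝ}

/-- [folklore] **«NT-7» WITH TOLERANCE `n⁸`: THE COMPLETED GHOST TADPOLE ROW `h₇`** — displayed: `0 < a`; the block-row |·|-mass letter of the ghost leg,
`hM0 : ∀ n ≥ 2, ∀ x Y, Σ_{z ∈ B(Y)} |Ggh n a x z| ≤ cM` (n-free `cM`); and ONE scaling letter `|ωgh n · (x₀ n · cQ n)| ≤ k · n⁸` (reading (ii) ∕ ENDₛ at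
`s n = n⁻²`: `4N²a·n⁸`, take `k := 4N²a`; the record's `h₇_sharp` needed `k·n⁴`).  Output = `h₇` of `NeedleRowGlue.abs_gN_row_le_of_tables` VERBATIM
with `C₇ := k · (2 · cM)`. -/
theorem h₇_sharp₈ (ha : 0 < a)
    (hM0 : ∀ n : ℕ, 2 ≤ n → ∀ [NeZero n], ∀ x Y : Site 4, ∑ z ∈ B (n - 1) Y, |Ggh n a x z () ()| ≤ cM)
    (hk : ∀ n : ℕ, 2 ≤ n → |ωgh n * (x₀ n * cQ n)| ≤ k * (n : ℝ) ^ 8) (μ ν : Fin 4) :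
    ∀ n : ℕ, 2 ≤ n → ∀ [NeZero n], |ωgh n * ∑ b ∈ (univ : Finset (Fin 4 → Fin n)).image resSite, ((n : ℝ) ^ 4)⁻¹ * (((n : ℝ) ^ 8)⁻¹ *
      fullSum (fun w : Pt => toReal w μ * toReal w ν *
        tadpoleTableA (Ggh n a) (WghAt (ctrHalf n) n (x₀ n) (cK n) (cQ n)) μ ν (b + w) b))| ≤ k * (2 * cM) := by
  intro n hn _
  have h1 : 1 ≤ n := le_trans (by norm_num) hn
  have hn1 : (1 : ℝ) ≤ n := by exact_mod_cast h1
  have hn0 : (0 : ℝ) < n := by linarith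
  have hcM : 0 ≤ cM := (Finset.sum_nonneg fun z _ => abs_nonneg _).trans (hM0 n hn 0 0)
  refine (abs_row₇_le_sharp₈ n (x₀ n) (cK n) (cQ n) ha (ωgh n) μ ν (fun x => hM0 n hn x 0)).trans ?_
  -- `n⁻⁸·(n−1)²·(n−1)² ≤ n⁻⁴` and `2cM·n⁻⁴ ≤ 2cM·n⁻⁴` with the product `n⁻⁴·n⁻⁴·k·n⁸ = k`
  have e1 : ((n - 1 : ℕ) : ℝ) = (n : ℝ) - 1 := by rw [Nat.cast_sub h1, Nat.cast_one]
  have hp : ((n : ℝ) ^ 8)⁻¹ * ((((n - 1 : ℕ) : ℝ)) ^ 2 * ((n : ℝ) - 1) ^ 2) ≤ ((n : ℝ) ^ 4)⁻¹ := by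
    rw [e1, ← pow_add, show (2 + 2 : ℕ) = 4 by norm_num]
    have h4 : ((n : ℝ) - 1) ^ 4 ≤ (n : ℝ) ^ 4 := pow_le_pow_left₀ (by linarith) (by linarith) 4
    calc ((n : ℝ) ^ 8)⁻¹ * ((n : ℝ) - 1) ^ 4 ≤ ((n : ℝ) ^ 8)⁻¹ * (n : ℝ) ^ 4 := mul_le_mul_of_nonneg_left h4 (by positivity)
      _ = ((n : ℝ) ^ 4)⁻¹ := by field_simp
  have hp0 : 0 ≤ ((n : ℝ) ^ 8)⁻¹ * ((((n - 1 : ℕ) : ℝ)) ^ 2 * ((n : ℝ) - 1) ^ 2) := by positivity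
  have hMS0 : 0 ≤ 2 * cM * ((n : ℝ) ^ 4)⁻¹ := by positivity
  have hk0 : 0 ≤ k * (n : ℝ) ^ 8 := (abs_nonneg _).trans (hk n hn)
  calc |ωgh n| * (|x₀ n * cQ n| * (((n : ℝ) ^ 8)⁻¹ * ((((n - 1 : ℕ) : ℝ)) ^ 2 * (((n : ℝ) - 1) ^ 2 * (2 * cM * ((n : ℝ) ^ 4)⁻¹)))))
      = |ωgh n * (x₀ n * cQ n)| * ((((n : ℝ) ^ 8)⁻¹ * ((((n - 1 : ℕ) : ℝ)) ^ 2 * ((n : ℝ) - 1) ^ 2)) * (2 * cM * ((n : ℝ) ^ 4)⁻¹)) := by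
        rw [abs_mul (ωgh n)]; ring
    _ ≤ (k * (n : ℝ) ^ 8) * (((n : ℝ) ^ 4)⁻¹ * (2 * cM * ((n : ℝ) ^ 4)⁻¹)) :=
        mul_le_mul (hk n hn) (mul_le_mul_of_nonneg_right hp hMS0) (by positivity) hk0
    _ = k * (2 * cM) := by field_simp

/-- [folklore] **«NT-7» WITH TOLERANCE `n⁸`, CLOSED FORM** — the leg letter `hM0` discharged by `NeedleGhostTadpoleRowClosed.rowMass_Ggh_le_cNear`
(`GhostLegBlockMass.sum_B_abs_Ggh_le` at block distance 0); displayed: `0 < a` and `|ωgh n·(x₀ n·cQ n)| ≤ k·n⁸` for `n ≥ 2`.  Output = `h₇` of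
`NeedleRowGlue.abs_gN_row_le_of_tables` VERBATIM with `C₇ := k·(2·cNear a)`. -/
theorem h₇_of_scaling₈ (ha : 0 < a) (hk : ∀ n : ℕ, 2 ≤ n → |ωgh n * (x₀ n * cQ n)| ≤ k * (n : ℝ) ^ 8) (μ ν : Fin 4) :
    ∀ n : ℕ, 2 ≤ n → ∀ [NeZero n], |ωgh n * ∑ b ∈ (univ : Finset (Fin 4 → Fin n)).image resSite, ((n : ℝ) ^ 4)⁻¹ * (((n : ℝ) ^ 8)⁻¹ *
      fullSum (fun w : Pt => toReal w μ * toReal w ν *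
        tadpoleTableA (Ggh n a) (WghAt (ctrHalf n) n (x₀ n) (cK n) (cQ n)) μ ν (b + w) b))| ≤ k * (2 * cNear a) :=
  h₇_sharp₈ ha (fun n _ _ x Y => rowMass_Ggh_le_cNear n ha x Y) hk μ ν

end Glue

end Summit.QuantumFields.BalabanUV.Beta.D1BFx.NeedleGhostTadpoleRowMass8

end
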